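import Summits.MatrixMultiplication.OmegaCensus.ThreeSetLineNormFilterDefs
import Summits.MatrixMultiplication.OmegaCensus.ThreeSetLinePackedCyclotomic
import HarnessLib

/-!
# The certificate-free NORM FILTER for the three-set line identity, II: algebra of the half-norm and the numeral lemmas

ω-census `pub-omega`, family (b3), seat pub-omega-group gen 41.  Framing: lottery ticket; floor = certified bounds/negative
ranges.  VALUE: a kernel TOOL (lemmas for `ThreeSetLineNormFilter`); NOT progress on ω.
* `sig_comp_apply` (`σ_a ∘ σ_b = σ_{ab}`), `Tprod` (`T_k z = ∏_{i<k} σ_{g^i} z`), `Tprod_succ`, `Tprod_double`,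
  `normS_eq_Tprod` (primitive root `g` with a checked discrete-log table), `normS_eq_mul_self` (`Nm z = n·n` when `T_h z = n`);
* `Phi_unitN`, `Phi_jN` (`J ↦ −1`), `tower_sound`, `Phi_dNum` (`↦ D_X`), `Phi_gNum` (`↦ Γ_s`), `gamma_exponents`, `tval_sound`.
-/

namespace Summit.MatrixMultiplication.OmegaCensus

open Finset Polynomial LineInv

namespace LineNorm

/-! ## Algebra in `S`: composing the `σ_j`, the half-norm product, primitive roots -/

section Alg

variable (p : ℕ) [hp : Fact p.Prime]

/-- `p ∤ a`, `p ∤ b` ⇒ `p ∤ ab mod p`. [folklore] -/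
theorem not_dvd_mul_mod {a b : ℕ} (ha : ¬ p ∣ a) (hb : ¬ p ∣ b) : ¬ p ∣ a * b % p := by
  intro h
  have hab : ¬ p ∣ a * b := fun h' => (hp.out.dvd_mul.1 h').elim ha hb
  have hlt : a * b % p < p := Nat.mod_lt _ hp.out.pos
  rcases Nat.eq_zero_or_pos (a * b % p) with h0 | hpos
  · exact hab (Nat.dvd_of_mod_eq_zero h0)
  · exact absurd (Nat.le_of_dvd hpos h) (not_le.2 hlt)

/-- `p ∤ g` ⇒ `p ∤ g^i mod p`. [folklore] -/
theorem not_dvd_pow_mod {g : ℕ} (hg : ¬ p ∣ g) (i : ℕ) : ¬ p ∣ g ^ i % p := by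
  intro h
  have hgi : ¬ p ∣ g ^ i := fun h' => hg (hp.out.dvd_of_dvd_pow h')
  have hlt : g ^ i % p < p := Nat.mod_lt _ hp.out.pos
  rcases Nat.eq_zero_or_pos (g ^ i % p) with h0 | hpos
  · exact hgi (Nat.dvd_of_mod_eq_zero h0)
  · exact absurd (Nat.le_of_dvd hpos h) (not_le.2 hlt)

/-- `σ_a ∘ σ_b = σ_{ab}`. [folklore] -/
theorem sig_mk {j : ℕ} (hj : ¬ p ∣ j) (q : ℤ[X]) :
    sig p j hj (AdjoinRoot.mk (cyclotomic p ℤ) q) = q.eval₂ (AdjoinRoot.of (cyclotomic p ℤ)) (rho p ^ j) := by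
  unfold sig; exact AdjoinRoot.lift_mk _ q

/-- `σ_a ∘ σ_b = σ_{ab}`. [folklore] -/
theorem sig_comp_apply {a b : ℕ} (ha : ¬ p ∣ a) (hb : ¬ p ∣ b) (z : S p) :
    sig p a ha (sig p b hb z) = sig p (a * b % p) (not_dvd_mul_mod p ha hb) z := by
  induction z using AdjoinRoot.induction_on with
  | ih q =>
    rw [sig_mk, sig_mk, Polynomial.hom_eval₂, map_pow, sig_rho, ← pow_mul, pow_mod_eq_pow (root_pow_p p)]
    congr 1
    exact RingHom.ext_int _ _

/-- Proof-irrelevant index change. [folklore] -/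
theorem sig_congr {a b : ℕ} (h : a = b) (ha : ¬ p ∣ a) (hb : ¬ p ∣ b) (z : S p) : sig p a ha z = sig p b hb z := by subst h; rfl

/-- The half-norm product `T_k z = ∏_{i<k} σ_{g^i} z`. [folklore] -/
noncomputable def Tprod (g : ℕ) (hg : ¬ p ∣ g) (k : ℕ) (z : S p) : S p :=
  ∏ i ∈ range k, sig p (g ^ i % p) (not_dvd_pow_mod p hg i) z

/-- `T_{k+1} z = T_k z · σ_{g^k} z`. [folklore] -/
theorem Tprod_succ {g : ℕ} (hg : ¬ p ∣ g) (k : ℕ) (z : S p) :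
    Tprod p g hg (k + 1) z = Tprod p g hg k z * sig p (g ^ k % p) (not_dvd_pow_mod p hg k) z := by unfold Tprod; rw [prod_range_succ]

/-- `T_{2k} z = T_k z · σ_{g^k} (T_k z)`. [folklore] -/
theorem Tprod_double {g : ℕ} (hg : ¬ p ∣ g) (k : ℕ) (z : S p) :
    Tprod p g hg (2 * k) z = Tprod p g hg k z * sig p (g ^ k % p) (not_dvd_pow_mod p hg k) (Tprod p g hg k z) := by
  unfold Tprod
  rw [two_mul, prod_range_add, map_prod]
  congr 1
  refine prod_congr rfl fun i _ => ?_
  rw [sig_comp_apply]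
  exact sig_congr p (by rw [pow_add, Nat.mul_mod]) _ _ z

/-- `σ_1 = id`. [folklore] -/
theorem sig_one_apply (h1 : ¬ p ∣ 1) (z : S p) : sig p 1 h1 z = z := by
  induction z using AdjoinRoot.induction_on with
  | ih q =>
    unfold sig
    rw [AdjoinRoot.lift_mk, pow_one]
    unfold rho
    rw [← AdjoinRoot.algebraMap_eq, ← Polynomial.aeval_def, AdjoinRoot.aeval_eq]

/-- `T_1 z = z`. [folklore] -/
theorem Tprod_one {g : ℕ} (hg : ¬ p ∣ g) (z : S p) : Tprod p g hg 1 z = z := by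
  unfold Tprod; rw [prod_range_one]
  have e : g ^ 0 % p = 1 := by rw [pow_zero]; exact Nat.mod_eq_of_lt hp.out.one_lt
  rw [sig_congr p e _ (fun h => hp.out.one_lt.ne' (Nat.eq_one_of_dvd_one h)) z, sig_one_apply]

/-- **`Nm = T_{p−1}`** for a primitive root `g` (with a checked discrete-log table). [folklore] -/
theorem normS_eq_Tprod {g : ℕ} (hg : ¬ p ∣ g) {dlog : List ℕ} (hdl : dlogChk p g dlog = true) (z : S p) :
    normS p z = Tprod p g hg (p - 1) z := by
  unfold dlogChk at hdl
  rw [Bool.and_eq_true, List.all_eq_true, List.all_eq_true] at hdl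
  obtain ⟨h1, h2⟩ := hdl
  have h1' : ∀ i, i < p - 1 → 1 ≤ g ^ i % p ∧ dlog.getD (g ^ i % p) 0 = i := fun i hi => by
    have h := h1 i (List.mem_range.2 hi)
    rw [Bool.and_eq_true, decide_eq_true_eq, beq_iff_eq] at h
    exact h
  have h2' : ∀ j, j < p - 1 → dlog.getD (j + 1) 0 < p - 1 ∧ g ^ (dlog.getD (j + 1) 0) % p = j + 1 := fun j hj => by
    have h := h2 j (List.mem_range.2 hj)
    rw [Bool.and_eq_true, decide_eq_true_eq, beq_iff_eq] at h
    exact h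
  -- `normS` as a product over `range (p − 1)` of a total function
  let f : ℕ → S p := fun j => if hj : j < p - 1 then sig p (j + 1) (not_dvd_succ_of_lt p hj) z else 1
  have ef : normS p z = ∏ j ∈ range (p - 1), f j := by
    unfold normS
    rw [← prod_attach (range (p - 1)) f]
    refine prod_congr rfl fun j _ => ?_
    simp only [f, dif_pos (mem_range.1 j.2)]
  rw [ef]
  unfold Tprod
  symm
  refine prod_nbij' (fun i => g ^ i % p - 1) (fun j => dlog.getD (j + 1) 0) (fun i hi => ?_) (fun j hj => ?_)
    (fun i hi => ?_) (fun j hj => ?_) (fun i hi => ?_)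
  · have := Nat.mod_lt (g ^ i) hp.out.pos
    have := hp.out.two_le
    rw [mem_range]; omega
  · exact mem_range.2 (h2' j (mem_range.1 hj)).1
  · obtain ⟨hge, hdl⟩ := h1' i (mem_range.1 hi)
    rw [Nat.sub_add_cancel hge, hdl]
  · obtain ⟨_, hpow⟩ := h2' j (mem_range.1 hj)
    rw [hpow]; rfl
  · obtain ⟨hge, _⟩ := h1' i (mem_range.1 hi)
    have hlt : g ^ i % p - 1 < p - 1 := by have := Nat.mod_lt (g ^ i) hp.out.pos; have := hp.out.two_le; omega
    simp only [f, dif_pos hlt]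
    exact sig_congr p (Nat.sub_add_cancel hge).symm _ _ z

/-- **`Nm z = n·n`** when the half-norm `T_h z` is the integer `n` (`2h = p − 1`, `g` primitive). [folklore] -/
theorem normS_eq_mul_self {g : ℕ} (hg : ¬ p ∣ g) {dlog : List ℕ} (hdl : dlogChk p g dlog = true) {h : ℕ}
    (h2 : 2 * h = p - 1) {z : S p} {n : ℤ} (hT : Tprod p g hg h z = (n : S p)) : normS p z = (n : S p) * (n : S p) := by
  rw [normS_eq_Tprod p hg hdl, ← h2, Tprod_double, hT, sig_intCast]

end Alg

/-! ## The numeral primitives `unitN`, `jN` and the tower -/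

section Num

variable {p : ℕ} [hp : Fact p.Prime] {X : ℕ}

/-- `encR` of a monomial list. [folklore] -/
theorem encR_replicate_zero_append_one {R : Type*} [CommRing R] (x : R) (e : ℕ) :
    encR x (List.replicate e 0 ++ [1]) = x ^ e := by
  induction e with
  | zero => simp [encR]
  | succ e ih => rw [List.replicate_succ, List.cons_append, encR, ih, pow_succ]; push_cast; ring

omit hp in
/-- **`unitN`**: `Phi (unitN X e) = ρ^e`, `mass = 1`, `< X^p` (`e < p`, `2 ≤ X`). [folklore] -/
theorem Phi_unitN (hX : 2 ≤ X) {e : ℕ} (he : e < p) :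
    Phi p X (unitN X e) = rho p ^ e ∧ mass p X (unitN X e) = 1 ∧ unitN X e < X ^ p := by
  have hlt : ∀ a ∈ List.replicate e 0 ++ [1], a < X := fun a ha => by
    rw [List.mem_append, List.mem_replicate, List.mem_singleton] at ha
    rcases ha with ⟨_, rfl⟩ | rfl <;> omega
  have hlen : (List.replicate e 0 ++ [1]).length ≤ p := by simp; omega
  refine ⟨?_, ?_, ?_⟩
  · rw [unitN, Phi_enc (by omega) _ hlt hlen, encR_replicate_zero_append_one]
  · rw [unitN, mass_enc (by omega) _ hlt hlen]; simp
  · rw [unitN]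
    exact lt_of_lt_of_le (enc_lt _ hlt) (Nat.pow_le_pow_right (by omega) hlen)

/-- **`jN`**: `Phi (jN p X) = −1`, `mass = p − 1`, `< X^p` (`2 ≤ X`). [folklore] -/
theorem Phi_jN (hX : 2 ≤ X) : Phi p X (jN p X) = -1 ∧ mass p X (jN p X) = p - 1 ∧ jN p X < X ^ p := by
  obtain ⟨q, hq⟩ : ∃ q, p = q + 1 := ⟨p - 1, by have := hp.out.one_lt; omega⟩
  subst hq
  have hlt : ∀ a ∈ (0 :: List.replicate (q + 1 - 1) 1), a < X := fun a ha => by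
    rw [List.mem_cons, List.mem_replicate] at ha
    rcases ha with rfl | ⟨_, rfl⟩ <;> omega
  have hlen : (0 :: List.replicate (q + 1 - 1) 1).length ≤ q + 1 := by simp
  refine ⟨?_, ?_, ?_⟩
  · rw [jN, Phi_enc (by omega) _ hlt hlen, encR_eq_sum]
    have elen : (0 :: List.replicate (q + 1 - 1) 1).length = q + 1 := by simp
    rw [elen, Finset.sum_range_succ']
    simp only [List.getD_cons_zero, Nat.cast_zero, zero_mul, add_zero, List.getD_cons_succ, Nat.add_sub_cancel]
    have h := geom_sum_root (q + 1)
    rw [Finset.sum_range_succ', pow_zero] at h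
    have e2 : ∀ v ∈ range q, (((List.replicate q 1).getD v 0 : ℕ) : S (q + 1)) * rho (q + 1) ^ (v + 1) =
        rho (q + 1) ^ (v + 1) := by
      intro v hv
      rw [List.getD_eq_getElem?_getD, List.getElem?_replicate, if_pos (mem_range.1 hv)]
      simp
    rw [Finset.sum_congr rfl e2]
    linear_combination h
  · rw [jN, mass_enc (by omega) _ hlt hlen]; simp
  · rw [jN]
    exact lt_of_lt_of_le (enc_lt _ hlt) (Nat.pow_le_pow_right (by omega) hlen)

/-- Powers of an inverse pair stay inverse: `(g^k mod p)(gi^k mod p) ≡ 1`. [folklore] -/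
theorem pow_mul_pow_mod {g gi : ℕ} (hg : g * gi % p = 1) (k : ℕ) : (g ^ k % p) * (gi ^ k % p) % p = 1 := by
  rw [← Nat.mul_mod, ← mul_pow, Nat.pow_mod, hg, one_pow]
  exact Nat.mod_eq_of_lt hp.out.one_lt

/-- `(p−1)² ≡ 1 (mod p)`. [folklore] -/
theorem pm1_mul_pm1_mod : (p - 1) * (p - 1) % p = 1 := by
  have hp2 : 2 ≤ p := hp.out.two_le
  have e : (p - 1) * (p - 1) = (p - 2) * p + 1 := by
    obtain ⟨q, hq⟩ : ∃ q, p = q + 2 := ⟨p - 2, by omega⟩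
    subst hq; simp; ring
  rw [e, Nat.add_mod, Nat.mul_mod_left, zero_add, Nat.mod_mod]
  exact Nat.mod_eq_of_lt (by omega)

/-- Monotonicity of powers in the exponent, including base `0` with positive exponents. [folklore] -/
theorem pow_le_pow_exp (m : ℕ) {i j : ℕ} (hi : 1 ≤ i) (hij : i ≤ j) : m ^ i ≤ m ^ j := by
  rcases Nat.eq_zero_or_pos m with rfl | hm
  · rw [zero_pow (by omega), zero_pow (by omega)]
  · exact Nat.pow_le_pow_right hm hij

omit hp in
/-- The tower exponent is positive. [folklore] -/
theorem tower_k_pos (gi : ℕ) : ∀ (st : List Bool) (z : ℕ), 1 ≤ (tower p X gi st z).2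
  | [], z => le_refl 1
  | true :: st, z => by have := tower_k_pos gi st z; simp only [tower]; omega
  | false :: st, z => by simp only [tower]; omega

omit hp in
/-- The tower exponent does not depend on `z`. [folklore] -/
theorem tower_k_eq (gi : ℕ) : ∀ (st : List Bool) (z z' : ℕ), (tower p X gi st z).2 = (tower p X gi st z').2
  | [], _, _ => rfl
  | true :: st, z, z' => by simp only [tower]; rw [tower_k_eq gi st z z']
  | false :: st, z, z' => by simp only [tower]; rw [tower_k_eq gi st z z']

/-- **Soundness of the tower**: `Phi (T.1) = T_k (Phi z)`, `mass (T.1) = (mass z)^k`, `T.1 < X^p`, provided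
`(mass z)^k < X` for the final `k`. [folklore] -/
theorem tower_sound (hX : 2 ≤ X) {g gi : ℕ} (hg : g * gi % p = 1) {z : ℕ} (hz : z < X ^ p) :
    ∀ st : List Bool, mass p X z ^ (tower p X gi st z).2 < X →
      Phi p X (tower p X gi st z).1 = Tprod p g (not_dvd_of_mul_mod_eq_one hg) (tower p X gi st z).2 (Phi p X z) ∧
      mass p X (tower p X gi st z).1 = mass p X z ^ (tower p X gi st z).2 ∧ (tower p X gi st z).1 < X ^ p
  | [], _ => by simp only [tower]; rw [Tprod_one, pow_one]; exact ⟨rfl, rfl, hz⟩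
  | true :: st, hB => by
    simp only [tower] at hB ⊢
    have hk := tower_k_pos (p := p) (X := X) gi st z
    obtain ⟨ih1, ih2, ih3⟩ := tower_sound hX hg hz st
      (lt_of_le_of_lt (pow_le_pow_exp _ hk (Nat.le_mul_of_pos_left _ (by norm_num))) hB)
    obtain ⟨q1, q2, q3⟩ := Phi_perm (p := p) (by omega : 0 < X) (pow_mul_pow_mod hg (tower p X gi st z).2)
      (tower p X gi st z).1
    have hm : mass p X (tower p X gi st z).1 * mass p X (perm p X (gi ^ (tower p X gi st z).2 % p)
        (tower p X gi st z).1) < X := by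
      rw [q2, ih2, ← pow_add, ← two_mul]; exact hB
    obtain ⟨c1, c2, c3⟩ := Phi_cmul (p := p) (by omega : 0 < X) ih3 q3 hm
    refine ⟨?_, ?_, c3⟩
    · rw [c1, q1, ih1, Tprod_double]
    · rw [c2, q2, ih2, ← pow_add, ← two_mul]
  | false :: st, hB => by
    simp only [tower] at hB ⊢
    have hk := tower_k_pos (p := p) (X := X) gi st z
    obtain ⟨ih1, ih2, ih3⟩ := tower_sound hX hg hz st (lt_of_le_of_lt (pow_le_pow_exp _ hk (Nat.le_succ _)) hB)
    obtain ⟨q1, q2, q3⟩ := Phi_perm (p := p) (by omega : 0 < X) (pow_mul_pow_mod hg (tower p X gi st z).2) z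
    have hm : mass p X (tower p X gi st z).1 * mass p X (perm p X (gi ^ (tower p X gi st z).2 % p) z) < X := by
      rw [q2, ih2, ← pow_succ]; exact hB
    obtain ⟨c1, c2, c3⟩ := Phi_cmul (p := p) (by omega : 0 < X) ih3 q3 hm
    refine ⟨?_, ?_, c3⟩
    · rw [c1, q1, ih1, Tprod_succ]
    · rw [c2, q2, ih2, ← pow_succ]

/-- `σ_{p−1}` turns `lev` into `levc`. [folklore] -/
theorem sig_pm1_lev (h : ¬ p ∣ p - 1) (F : ZMod p → ℕ) : sig p (p - 1) h (lev (rho p) F) = levc (rho p) F := by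
  rw [← LineUnit.lev_pow_pred (LineNorm.root_pow_p p), lev, lev, map_sum]
  refine Finset.sum_congr rfl fun v _ => ?_
  rw [map_mul, map_natCast, zch, zch, map_pow, sig_rho, ← pow_mul]

/-- `n ≤ 3n²`. [folklore] -/
theorem le_three_mul_sq (n : ℕ) : n ≤ 3 * n ^ 2 := by
  rcases Nat.eq_zero_or_pos n with rfl | h
  · simp
  · calc n = n * 1 := (mul_one n).symm
      _ ≤ n * n := Nat.mul_le_mul_left n h
      _ ≤ 3 * n ^ 2 := by rw [sq]; omega

/-- **`dNum`** is `D_X`: `Phi`, exact `mass = 3 (Σ F · Σ W)²`, `< X^p`. [folklore] -/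
theorem Phi_dNum (hX : 2 ≤ X) {W F : List ℕ} (hW : W.length = p) (hF : F.length = p) (hWX : W.sum < X)
    (hFX : F.sum < X) (hB : 3 * (F.sum * W.sum) ^ 2 < X) :
    Phi p X (dNum p X (ofList X W) (perm p X (p - 1) (ofList X W)) F) =
      (lev (rho p) (vecFn F : ZMod p → ℕ) * levc (rho p) (vecFn W : ZMod p → ℕ)) ^ 2 +
      (lev (rho p) (vecFn F : ZMod p → ℕ) * levc (rho p) (vecFn W : ZMod p → ℕ)) *
        (levc (rho p) (vecFn F : ZMod p → ℕ) * lev (rho p) (vecFn W : ZMod p → ℕ)) +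
      (levc (rho p) (vecFn F : ZMod p → ℕ) * lev (rho p) (vecFn W : ZMod p → ℕ)) ^ 2 ∧
    mass p X (dNum p X (ofList X W) (perm p X (p - 1) (ofList X W)) F) = 3 * (F.sum * W.sum) ^ 2 ∧
    dNum p X (ofList X W) (perm p X (p - 1) (ofList X W)) F < X ^ p := by
  have hX0 : 0 < X := by omega
  have h3 : 3 * ((F.sum * W.sum) * (F.sum * W.sum)) < X := by rw [sq] at hB; exact hB
  have hm1 : F.sum * W.sum < X := lt_of_le_of_lt (le_three_mul_sq _) hB
  have hm2 : (F.sum * W.sum) * (F.sum * W.sum) < X := by omega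
  -- the pieces
  obtain ⟨w1, w2, w3⟩ : Phi p X (ofList X W) = lev (rho p) (vecFn W : ZMod p → ℕ) ∧ mass p X (ofList X W) = W.sum ∧
      ofList X W < X ^ p := ⟨Phi_ofList hX0 hW hWX, mass_ofList hX0 hW hWX, ofList_lt hW hWX⟩
  obtain ⟨x1, x2, x3⟩ : Phi p X (ofList X F) = lev (rho p) (vecFn F : ZMod p → ℕ) ∧ mass p X (ofList X F) = F.sum ∧
      ofList X F < X ^ p := ⟨Phi_ofList hX0 hF hFX, mass_ofList hX0 hF hFX, ofList_lt hF hFX⟩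
  obtain ⟨wc1, wc2, wc3⟩ := Phi_perm (p := p) (X := X) hX0 (pm1_mul_pm1_mod (p := p)) (ofList X W)
  obtain ⟨xc1, xc2, xc3⟩ := Phi_perm (p := p) (X := X) hX0 (pm1_mul_pm1_mod (p := p)) (ofList X F)
  rw [w1, sig_pm1_lev] at wc1
  rw [x1, sig_pm1_lev] at xc1
  rw [w2] at wc2
  rw [x2] at xc2
  -- A, B
  obtain ⟨a1, a2, a3⟩ := Phi_cmul (p := p) hX0 x3 wc3 (by rw [x2, wc2]; exact hm1)
  obtain ⟨b1, b2, b3⟩ := Phi_cmul (p := p) hX0 xc3 w3 (by rw [xc2, w2]; exact hm1)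
  rw [x1, wc1] at a1
  rw [xc1, w1] at b1
  rw [x2, wc2] at a2
  rw [xc2, w2] at b2
  -- AA, AB, BB
  obtain ⟨aa1, aa2, aa3⟩ := Phi_cmul (p := p) hX0 a3 a3 (by rw [a2]; exact hm2)
  obtain ⟨ab1, ab2, ab3⟩ := Phi_cmul (p := p) hX0 a3 b3 (by rw [a2, b2]; exact hm2)
  obtain ⟨bb1, bb2, bb3⟩ := Phi_cmul (p := p) hX0 b3 b3 (by rw [b2]; exact hm2)
  rw [a2] at aa2
  rw [a2, b2] at ab2
  rw [b2] at bb2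
  -- sums
  obtain ⟨s1, s2, s3⟩ := Phi_nadd (p := p) hX0 aa3 ab3 (by rw [aa2, ab2]; omega)
  obtain ⟨t1, t2, t3⟩ := Phi_nadd (p := p) hX0 s3 bb3 (by rw [s2, aa2, ab2, bb2]; omega)
  unfold dNum
  dsimp only
  refine ⟨?_, ?_, t3⟩
  · rw [t1, s1, aa1, ab1, bb1, a1, b1]; ring
  · rw [t2, s2, aa2, ab2, bb2]; ring

/-- **`gNum`** is `Γ_s` (`s < p`): `Phi`, exact `mass = (Σ W)²·(p + 1)`, `< X^p`. [folklore] -/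
theorem Phi_gNum (hX : 2 ≤ X) {W : List ℕ} (hW : W.length = p) (hWX : W.sum < X) (hB : W.sum ^ 2 * (p + 1) < X)
    {s : ℕ} (hs : s < p) :
    Phi p X (gNum p X (ofList X W) (perm p X (p - 1) (ofList X W)) s) =
      levc (rho p) (vecFn W : ZMod p → ℕ) ^ 2 * rho p ^ (2 * s % p) +
      lev (rho p) (vecFn W : ZMod p → ℕ) ^ 2 * rho p ^ (2 * (p - s) % p) -
      lev (rho p) (vecFn W : ZMod p → ℕ) * levc (rho p) (vecFn W : ZMod p → ℕ) ∧
    mass p X (gNum p X (ofList X W) (perm p X (p - 1) (ofList X W)) s) = W.sum ^ 2 * (p + 1) ∧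
    gNum p X (ofList X W) (perm p X (p - 1) (ofList X W)) s < X ^ p := by
  have hX0 : 0 < X := by omega
  have hp1 : 1 ≤ p := hp.out.one_lt.le
  have hsq : W.sum * W.sum ≤ W.sum ^ 2 * (p + 1) := by rw [sq]; exact Nat.le_mul_of_pos_right _ (by omega)
  have hm1 : W.sum * W.sum < X := lt_of_le_of_lt hsq hB
  obtain ⟨w1, w2, w3⟩ : Phi p X (ofList X W) = lev (rho p) (vecFn W : ZMod p → ℕ) ∧ mass p X (ofList X W) = W.sum ∧
      ofList X W < X ^ p := ⟨Phi_ofList hX0 hW hWX, mass_ofList hX0 hW hWX, ofList_lt hW hWX⟩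
  obtain ⟨wc1, wc2, wc3⟩ := Phi_perm (p := p) (X := X) hX0 (pm1_mul_pm1_mod (p := p)) (ofList X W)
  rw [w1, sig_pm1_lev] at wc1
  rw [w2] at wc2
  obtain ⟨u1, u2, u3⟩ := Phi_unitN (p := p) hX (Nat.mod_lt (2 * s) hp.out.pos)
  obtain ⟨v1, v2, v3⟩ := Phi_unitN (p := p) hX (Nat.mod_lt (2 * (p - s)) hp.out.pos)
  obtain ⟨j1, j2, j3⟩ := Phi_jN (p := p) (X := X) hX
  obtain ⟨cc1, cc2, cc3⟩ := Phi_cmul (p := p) hX0 wc3 wc3 (by rw [wc2]; exact hm1)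
  obtain ⟨ww1, ww2, ww3⟩ := Phi_cmul (p := p) hX0 w3 w3 (by rw [w2]; exact hm1)
  obtain ⟨n1, n2, n3⟩ := Phi_cmul (p := p) hX0 w3 wc3 (by rw [w2, wc2]; exact hm1)
  rw [wc2] at cc2
  rw [w2] at ww2
  rw [w2, wc2] at n2
  obtain ⟨p1, p2, p3⟩ := Phi_cmul (p := p) hX0 cc3 u3 (by rw [cc2, u2, mul_one]; exact hm1)
  obtain ⟨q1, q2, q3⟩ := Phi_cmul (p := p) hX0 ww3 v3 (by rw [ww2, v2, mul_one]; exact hm1)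
  obtain ⟨r1, r2, r3⟩ := Phi_cmul (p := p) hX0 n3 j3 (by
    rw [n2, j2]; refine lt_of_le_of_lt ?_ hB; rw [sq]; exact Nat.mul_le_mul_left _ (by omega))
  rw [cc2, u2] at p2
  rw [ww2, v2] at q2
  rw [n2, j2] at r2
  obtain ⟨s1, s2, s3⟩ := Phi_nadd (p := p) hX0 p3 q3 (by
    rw [p2, q2]; refine lt_of_le_of_lt ?_ hB; rw [sq]
    have := hp.out.two_le
    nlinarith)
  obtain ⟨t1, t2, t3⟩ := Phi_nadd (p := p) hX0 s3 r3 (by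
    rw [s2, p2, q2, r2]; refine lt_of_le_of_lt (le_of_eq ?_) hB
    rw [sq]; have : p - 1 + 2 = p + 1 := by omega
    rw [← this]; ring)
  unfold gNum
  refine ⟨?_, ?_, t3⟩
  · rw [t1, s1, p1, q1, r1, cc1, ww1, n1, wc1, w1, u1, v1, j1]; ring
  · rw [t2, s2, p2, q2, r2]
    have : p - 1 + 2 = p + 1 := by omega
    rw [← this]; ring

/-- The `Γ`-numeral value matches `Γ_s` of `ThreeSetLineNormDivisibility` for `s : ZMod p`. [folklore] -/
theorem gamma_exponents (s : ZMod p) :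
    rho p ^ (2 * s.val % p) = zch (rho p) s ^ 2 ∧ rho p ^ (2 * (p - s.val) % p) = zch (rho p) (-s) ^ 2 := by
  have h1 := root_pow_p p
  haveI : NeZero p := ⟨hp.out.ne_zero⟩
  refine ⟨?_, ?_⟩
  · rw [pow_mod_eq_pow h1, zch, ← pow_mul, mul_comm]
  · rw [pow_mod_eq_pow h1, zch, ZMod.neg_val]
    split_ifs with hs
    · rw [hs, ZMod.val_zero, Nat.sub_zero, pow_zero, one_pow, mul_comm, pow_mul, h1, one_pow]
    · rw [← pow_mul, mul_comm]

/-- **`tval`**: if the tower result reads as the integer `n`, then `T_k (Phi z) = n`. [folklore] -/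
theorem tval_sound (hX : 2 ≤ X) {g gi : ℕ} (hg : g * gi % p = 1) {st : List Bool} {z : ℕ} (hz : z < X ^ p)
    (hB : mass p X z ^ (tower p X gi st z).2 < X) {n : ℤ} (h : tval p X gi st z = some n) :
    Tprod p g (not_dvd_of_mul_mod_eq_one hg) (tower p X gi st z).2 (Phi p X z) = (n : S p) := by
  unfold tval at h
  split_ifs at h with hc
  rw [Option.some.injEq] at h
  obtain ⟨t1, _, _⟩ := tower_sound hX hg hz st hB
  rw [← t1, Phi_eq_readInt hc, h]

end Num

end LineNorm

end Summit.MatrixMultiplication.OmegaCensus
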